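import Summits.NavierStokesRegularity.NavierStokesRegularity.Theorems.ExtremiserTransienceNearExtremalTransienceExtremiserLiouvilleConvergence
import Summits.NavierStokesRegularity.NavierStokesRegularity.Theorems.ExtremiserTransienceNearExtremalTransienceExtremiserLiouvilleDensityErrors
import Summits.NavierStokesRegularity.NavierStokesRegularity.Theorems.ExtremiserTransienceNearExtremalTransienceExtremiserLiouvilleFarFieldLimit
import Literature.Analysis.FluidPDE.KNSSThm53OfWindow
import HarnessLib

/-!
# Crux `ExtremiserTransience.NearExtremalTransience` (stmt-NavierStokesRegularity-21883), line `extremiser_liouville`,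
# stub K1b — THE DENSITY LEAF (part 4c, assembly)

`--supports stmt-NavierStokesRegularity-21883` (helper).  Author: prover seat `ns-el-k1b` (g2).

**`density_leaf`** — the hypothesis `hdens` of `ExtremiserLiouville.extendedSharp_of_density`
(`…NoAnalyticExtremalReduction`, g0) PROVED: every field `w` of the stub's extended class (`C^∞`, divergence free,
`‖w‖ ≤ M`, `‖Dw‖ ≤ B`, `D¹w, D²w ∈ L²`, no `L²` clause) is approximated, for every `ε > 0`, by a `C^∞_c` divergence-free
field `u` and a constant `b` with `‖u + b‖ ≤ M + ε` everywhere and stretching / enstrophy / palinstrophy integrals within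
`ε` of those of `w`.  Construction: `b = c` the far-field limit of `w` (part 1), `u = solenoidalTruncation (w − c) R`
(the tree's Poincaré-homotopy truncation) for `R` large: the errors of `Z, P, S` are controlled by parts 4a/4b and the
sup bound by part 3b's order-zero bound and the decay of the Poincaré field (part 2).

Consequence (separate closer files): `HomogeneousSharpConstant` (stmt-26686) by `extendedSharp_of_density density_leaf`,
then `DecayingSharpConstant` (26687) and `GalileanGainLeTwo` (26688) by the landed Galilean-gauge implications; and
K1b ⟸ «no analytic extended extremiser with plateau at infinity» alone (`…NoAnalyticExtremalFarFieldGap`).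

WHAT THIS IS NOT: not K1b, not the crux; a static density statement about admissible fields.  The crux NET, rung N0
and NS regularity stay OPEN — nothing here proves NS regularity. [folklore]
-/

noncomputable section

open Set Filter Topology MeasureTheory Metric Function
open scoped ENNReal NNReal Topology InnerProductSpace RealInnerProductSpace
open Literature.Analysis.FluidPDE Literature.Analysis

namespace Summit.NavierStokesRegularity.NavierStokesRegularity.Theorems

-- the problem directory repeats the summit name (`NavierStokesRegularity/NavierStokesRegularity`)
set_option linter.dupNamespace false

namespace ExtremiserLiouville

/-! ## Small analytic helpers -/

/-- The error shape `C₁ e + C₂ e^{1/2} Q` tends to `0` with `e`. [folklore] -/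
theorem tendsto_errShape {e : ℝ → ℝ≥0∞} (he : Tendsto e atTop (𝓝 0)) {C₁ C₂ Q : ℝ≥0∞} (hC₁ : C₁ ≠ ⊤)
    (hC₂ : C₂ ≠ ⊤) (hQ : Q ≠ ⊤) :
    Tendsto (fun R => C₁ * e R + C₂ * (e R) ^ (1 / 2 : ℝ) * Q) atTop (𝓝 0) := by
  have h1 : Tendsto (fun R => C₁ * e R) atTop (𝓝 0) := by
    simpa using ENNReal.Tendsto.const_mul he (Or.inr hC₁)
  have hsqrt : Tendsto (fun R => (e R) ^ (1 / 2 : ℝ)) atTop (𝓝 0) := by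
    have hc := (ENNReal.continuous_rpow_const (y := (1 / 2 : ℝ))).tendsto (0 : ℝ≥0∞)
    rw [ENNReal.zero_rpow_of_pos (by norm_num : (0 : ℝ) < 1 / 2)] at hc
    exact hc.comp he
  have h2 : Tendsto (fun R => C₂ * (e R) ^ (1 / 2 : ℝ) * Q) atTop (𝓝 0) := by
    have := ENNReal.Tendsto.const_mul hsqrt (Or.inr hC₂)
    have := ENNReal.Tendsto.mul_const this (Or.inr hQ)
    simpa using this
  simpa using h1.add h2

/-- Sup bound of the Poincaré field: `‖F(x)‖ ≤ A` when `‖V‖ ≤ A`. [folklore] -/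
theorem norm_poincareField_le {V : EuclideanSpace ℝ (Fin 3) → EuclideanSpace ℝ (Fin 3)} {A : ℝ}
    (hA : ∀ y, ‖V y‖ ≤ A) (x : EuclideanSpace ℝ (Fin 3)) : ‖poincareField V x‖ ≤ A := by
  have hA0 : 0 ≤ A := (norm_nonneg _).trans (hA 0)
  rw [poincareField_apply]
  have hb : ∀ t ∈ Set.uIoc (0 : ℝ) 1, ‖t • V (t • x)‖ ≤ A := by
    intro t ht
    rw [uIoc_of_le zero_le_one] at ht
    rw [norm_smul, Real.norm_of_nonneg ht.1.le]
    calc t * ‖V (t • x)‖ ≤ 1 * A := mul_le_mul ht.2 (hA _) (norm_nonneg _) zero_le_one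
      _ = A := one_mul A
  simpa using intervalIntegral.norm_integral_le_of_norm_le_const hb

/-- Sup bound of the derivative of the Poincaré field: `‖DF(x)‖ ≤ B` when `‖DV‖ ≤ B`. [folklore] -/
theorem norm_fderiv_poincareField_le {V : EuclideanSpace ℝ (Fin 3) → EuclideanSpace ℝ (Fin 3)} (hV : ContDiff ℝ 1 V)
    {B : ℝ} (hB : ∀ y, ‖fderiv ℝ V y‖ ≤ B) (x : EuclideanSpace ℝ (Fin 3)) : ‖fderiv ℝ (poincareField V) x‖ ≤ B := by
  have hB0 : 0 ≤ B := (norm_nonneg _).trans (hB 0)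
  rw [fderiv_poincareField hV x]
  have hb : ∀ t ∈ Set.uIoc (0 : ℝ) 1, ‖(t ^ 2) • fderiv ℝ V (t • x)‖ ≤ B := by
    intro t ht
    rw [uIoc_of_le zero_le_one] at ht
    rw [norm_smul, Real.norm_of_nonneg (sq_nonneg t)]
    have ht1 : t ^ 2 ≤ 1 := by nlinarith [ht.1, ht.2]
    calc t ^ 2 * ‖fderiv ℝ V (t • x)‖ ≤ 1 * B := mul_le_mul ht1 (hB _) (norm_nonneg _) zero_le_one
      _ = B := one_mul B
  simpa using intervalIntegral.norm_integral_le_of_norm_le_const hb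

/-- `|a| ≤ ε` from `‖a‖ₑ ≤ ofReal ε`. [folklore] -/
theorem abs_le_of_enorm_le {a ε : ℝ} (hε : 0 ≤ ε) (h : ‖a‖ₑ ≤ ENNReal.ofReal ε) : |a| ≤ ε := by
  rw [← Real.norm_eq_abs, ← ENNReal.ofReal_le_ofReal_iff hε, ofReal_norm]
  exact h

/-! ## The density leaf -/

/-- **THE DENSITY LEAF of K1b** (hypothesis `hdens` of `extendedSharp_of_density`, verbatim): every field of the
stub's extended class is approximated by `C^∞_c` divergence-free fields plus a constant, with control of the sup norm
and of the stretching, enstrophy and palinstrophy integrals.  [folklore] -/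
theorem density_leaf :
    ∀ (w : EuclideanSpace ℝ (Fin 3) → EuclideanSpace ℝ (Fin 3)) (M B : ℝ), ContDiff ℝ (⊤ : ℕ∞) w → Literature.Analysis.FluidPDE.VectorCalculus.IsDivFree w → (∀ x, ‖w x‖ ≤ M) → (∀ x, ‖fderiv ℝ w x‖ ≤ B) → (∫⁻ x, ‖iteratedFDeriv ℝ 1 w x‖ₑ ^ 2 < ⊤) → (∫⁻ x, ‖iteratedFDeriv ℝ 2 w x‖ₑ ^ 2 < ⊤) → ∀ ε : ℝ, 0 < ε → ∃ (u : EuclideanSpace ℝ (Fin 3) → EuclideanSpace ℝ (Fin 3)) (b : EuclideanSpace ℝ (Fin 3)), ContDiff ℝ (⊤ : ℕ∞) u ∧ HasCompactSupport u ∧ Literature.Analysis.FluidPDE.VectorCalculus.IsDivFree u ∧ (∀ x, ‖u x + b‖ ≤ M + ε) ∧ |(∫ x, ⟪Literature.Analysis.FluidPDE.curl u x, fderiv ℝ u x (Literature.Analysis.FluidPDE.curl u x)⟫_ℝ) - ∫ x, ⟪Literature.Analysis.FluidPDE.curl w x, fderiv ℝ w x (Literature.Analysis.FluidPDE.curl w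 x)⟫_ℝ| ≤ ε ∧ |(∫ x, ‖Literature.Analysis.FluidPDE.curl u x‖ ^ 2) - ∫ x, ‖Literature.Analysis.FluidPDE.curl w x‖ ^ 2| ≤ ε ∧ |(∫ x, Literature.Analysis.FluidPDE.frobeniusNormSq (fderiv ℝ (Literature.Analysis.FluidPDE.curl u) x)) - ∫ x, Literature.Analysis.FluidPDE.frobeniusNormSq (fderiv ℝ (Literature.Analysis.FluidPDE.curl w) x)| ≤ ε := by
  intro w M B hcd hdiv hM hB h1 h2 ε hε
  have hw1 : ContDiff ℝ 1 w := contDiff_infty.1 hcd 1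
  have hw2 : ContDiff ℝ 2 w := contDiff_infty.1 hcd 2
  have hB0 : 0 ≤ B := (norm_nonneg _).trans (hB 0)
  have hM0 : 0 ≤ M := (norm_nonneg _).trans (hM 0)
  set κ : ℝ := ‖curlCLM‖ with hκ
  have hκ0 : 0 ≤ κ := norm_nonneg curlCLM
  -- Step 1: the far-field limit
  have hD : ∫⁻ x, ‖fderiv ℝ w x‖ₑ ^ 2 < ⊤ := by
    refine lt_of_le_of_lt (le_of_eq (lintegral_congr fun x => ?_)) h1
    rw [(enorm_iteratedFDeriv_one_two w x).1]
  obtain ⟨c, hcM, hdec, hmem⟩ := exists_farFieldLimit hw1 hM hB hD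
  set V : EuclideanSpace ℝ (Fin 3) → EuclideanSpace ℝ (Fin 3) := fun x => w x - c with hVdef
  have hV : ContDiff ℝ (⊤ : ℕ∞) V := hcd.sub contDiff_const
  have hV1 : ContDiff ℝ 1 V := contDiff_infty.1 hV 1
  have hVdiv : VectorCalculus.IsDivFree V := isDivFree_sub_const hdiv c
  have hVA : ∀ y, ‖V y‖ ≤ 2 * M := fun y => (norm_sub_le _ _).trans (by linarith [hM y])
  have hDV : fderiv ℝ V = fderiv ℝ w := funext fun y => fderiv_sub_const c
  have hcurlV : curl V = curl w := curl_sub_const_eq w c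
  have hiter : ∀ n : ℕ, iteratedFDeriv ℝ (n + 1) V = iteratedFDeriv ℝ (n + 1) w := by
    intro n
    ext1 y
    rw [iteratedFDeriv_succ_eq_comp_right, iteratedFDeriv_succ_eq_comp_right]
    simp only [Function.comp, hVdef, fderiv_sub_const]
  have hD1V : ∫⁻ x, ‖iteratedFDeriv ℝ 1 V x‖ₑ ^ 2 < ⊤ := by rw [hiter 0]; exact h1
  have hD2V : ∫⁻ x, ‖iteratedFDeriv ℝ 2 V x‖ₑ ^ 2 < ⊤ := by rw [hiter 1]; exact h2
  have hBV : ∀ y, ‖fderiv ℝ V y‖ ≤ B := fun y => by rw [hDV]; exact hB y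
  have hV6 : ∫⁻ x, ‖V x‖ₑ ^ 6 < ⊤ := by
    have h := lintegral_rpow_enorm_lt_top_of_eLpNorm_lt_top (by norm_num) (by norm_num) hmem.eLpNorm_lt_top
    simp only [ENNReal.toReal_ofNat] at h
    refine lt_of_le_of_lt (le_of_eq (lintegral_congr fun x => ?_)) h
    rw [show (6 : ℝ) = ((6 : ℕ) : ℝ) by norm_num, ENNReal.rpow_natCast]
  -- `L²` quantities of `w`
  have hZw : ∫⁻ x, ‖curl w x‖ₑ ^ 2 < ⊤ := by
    have hle : ∀ x, ‖curl w x‖ₑ ≤ ENNReal.ofReal κ * ‖iteratedFDeriv ℝ 1 w x‖ₑ := by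
      intro x
      have h := norm_curl_le w x
      rw [← norm_iteratedFDeriv_one] at h
      calc ‖curl w x‖ₑ = ENNReal.ofReal ‖curl w x‖ := (ofReal_norm _).symm
        _ ≤ ENNReal.ofReal (κ * ‖iteratedFDeriv ℝ 1 w x‖) := ENNReal.ofReal_le_ofReal h
        _ = ENNReal.ofReal κ * ‖iteratedFDeriv ℝ 1 w x‖ₑ := by rw [ENNReal.ofReal_mul hκ0, ofReal_norm]
    calc ∫⁻ x, ‖curl w x‖ₑ ^ 2 ≤ ∫⁻ x, (ENNReal.ofReal κ) ^ 2 * ‖iteratedFDeriv ℝ 1 w x‖ₑ ^ 2 :=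
          lintegral_mono fun x => by rw [← mul_pow]; exact pow_le_pow_left' (hle x) 2
      _ < ⊤ := by
          rw [lintegral_const_mul' _ _ (ENNReal.pow_ne_top ENNReal.ofReal_ne_top)]
          exact ENNReal.mul_lt_top (ENNReal.pow_lt_top ENNReal.ofReal_lt_top) h1
  have hPw : ∫⁻ x, ‖fderiv ℝ (curl w) x‖ₑ ^ 2 < ⊤ := by
    have hle : ∀ x, ‖fderiv ℝ (curl w) x‖ₑ ≤ ENNReal.ofReal κ * ‖iteratedFDeriv ℝ 2 w x‖ₑ := by
      intro x
      have h := norm_fderiv_curl_le hw2 x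
      calc ‖fderiv ℝ (curl w) x‖ₑ = ENNReal.ofReal ‖fderiv ℝ (curl w) x‖ := by
            exact (ofReal_norm (fderiv ℝ (curl w) x)).symm
        _ ≤ ENNReal.ofReal (κ * ‖iteratedFDeriv ℝ 2 w x‖) := ENNReal.ofReal_le_ofReal h
        _ = ENNReal.ofReal κ * ‖iteratedFDeriv ℝ 2 w x‖ₑ := by rw [ENNReal.ofReal_mul hκ0, ofReal_norm]
    calc ∫⁻ x, ‖fderiv ℝ (curl w) x‖ₑ ^ 2 ≤ ∫⁻ x, (ENNReal.ofReal κ) ^ 2 * ‖iteratedFDeriv ℝ 2 w x‖ₑ ^ 2 :=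
          lintegral_mono fun x => by rw [← mul_pow]; exact pow_le_pow_left' (hle x) 2
      _ < ⊤ := by
          rw [lintegral_const_mul' _ _ (ENNReal.pow_ne_top ENNReal.ofReal_ne_top)]
          exact ENNReal.mul_lt_top (ENNReal.pow_lt_top ENNReal.ofReal_lt_top) h2
  have hZV : ∫⁻ x, ‖curl V x‖ₑ ^ 2 < ⊤ := by rw [hcurlV]; exact hZw
  have hPV : ∫⁻ x, ‖fderiv ℝ (curl V) x‖ₑ ^ 2 < ⊤ := by rw [hcurlV]; exact hPw
  -- Step 2: the truncations and their uniform gradient bound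
  obtain ⟨K, hK0, hK⟩ := exists_truncation_error_bounds
  set Bu : ℝ := 2 * B + K * (4 * M + B) with hBu
  have hDu : ∀ R : ℝ, 1 ≤ R → ∀ x, ‖fderiv ℝ (solenoidalTruncation V R) x‖ ≤ Bu := by
    intro R hR x
    have hR0 : 0 < R := one_pos.trans_le hR
    have hb := (hK V hV R hR x).2.1
    have hdiff : ‖fderiv ℝ (solenoidalTruncation V R) x - fderiv ℝ V x‖ =
        ‖iteratedFDeriv ℝ 1 (fun x => solenoidalTruncation V R x - V x) x‖ := by
      rw [norm_iteratedFDeriv_one, fderiv_fun_sub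
        (((contDiff_infty.1 (contDiff_solenoidalTruncation hV R) 1).differentiable one_ne_zero) x)
        ((hV1.differentiable one_ne_zero) x)]
    have hF : ‖poincareField V x‖ ≤ 2 * M := norm_poincareField_le hVA x
    have hDF : ‖iteratedFDeriv ℝ 1 (poincareField V) x‖ ≤ B := by
      rw [norm_iteratedFDeriv_one]; exact norm_fderiv_poincareField_le hV1 hBV x
    have hRinv : R⁻¹ ≤ 1 := inv_le_one_of_one_le₀ hR
    have hind1 : {x : EuclideanSpace ℝ (Fin 3) | R ≤ ‖x‖}.indicator (fun x => ‖iteratedFDeriv ℝ 1 V x‖) x ≤ B := by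
      refine Set.indicator_apply_le' (fun _ => ?_) (fun _ => hB0)
      rw [hiter 0, norm_iteratedFDeriv_one]; exact hB x
    have hind2 : {x : EuclideanSpace ℝ (Fin 3) | R ≤ ‖x‖ ∧ ‖x‖ ≤ 2 * R}.indicator (fun x =>
        K * (R⁻¹ * ‖V x‖ + ‖iteratedFDeriv ℝ 1 (poincareField V) x‖ + R⁻¹ * ‖poincareField V x‖)) x ≤
        K * (4 * M + B) := by
      refine Set.indicator_apply_le' (fun _ => ?_) (fun _ => by positivity)
      gcongr K * ?_
      have e1 : R⁻¹ * ‖V x‖ ≤ 2 * M := by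
        calc R⁻¹ * ‖V x‖ ≤ 1 * (2 * M) := mul_le_mul hRinv (hVA x) (norm_nonneg _) zero_le_one
          _ = 2 * M := one_mul _
      have e2 : R⁻¹ * ‖poincareField V x‖ ≤ 2 * M := by
        calc R⁻¹ * ‖poincareField V x‖ ≤ 1 * (2 * M) := mul_le_mul hRinv hF (norm_nonneg _) zero_le_one
          _ = 2 * M := one_mul _
      linarith
    calc ‖fderiv ℝ (solenoidalTruncation V R) x‖
        ≤ ‖fderiv ℝ (solenoidalTruncation V R) x - fderiv ℝ V x‖ + ‖fderiv ℝ V x‖ := norm_le_norm_sub_add _ _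
      _ ≤ (B + K * (4 * M + B)) + B := by rw [hdiff]; exact add_le_add (hb.trans (add_le_add hind1 hind2)) (hBV x)
      _ = Bu := by rw [hBu]; ring
  -- Step 3: the vanishing errors
  have he₁ := tendsto_lintegral_iteratedFDeriv_one_sub hV hV6 hD1V
  have he₂ := tendsto_lintegral_iteratedFDeriv_two_sub hV hV6 hD1V hD2V
  have hΓZ := tendsto_errShape he₁ (C₁ := ENNReal.ofReal (κ ^ 2)) (C₂ := 2 * ENNReal.ofReal κ)
    (Q := (∫⁻ x, ‖curl V x‖ₑ ^ 2) ^ (1 / 2 : ℝ)) ENNReal.ofReal_ne_top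
    (ENNReal.mul_ne_top (by norm_num) ENNReal.ofReal_ne_top) (ENNReal.rpow_ne_top_of_nonneg (by norm_num) hZV.ne)
  have hΓP := tendsto_errShape he₂ (C₁ := 3 * ENNReal.ofReal (κ ^ 2)) (C₂ := 6 * ENNReal.ofReal κ)
    (Q := (∫⁻ x, ‖fderiv ℝ (curl V) x‖ₑ ^ 2) ^ (1 / 2 : ℝ)) (ENNReal.mul_ne_top (by norm_num) ENNReal.ofReal_ne_top)
    (ENNReal.mul_ne_top (by norm_num) ENNReal.ofReal_ne_top) (ENNReal.rpow_ne_top_of_nonneg (by norm_num) hPV.ne)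
  have hΓS := tendsto_errShape he₁ (C₁ := ENNReal.ofReal (κ ^ 2 * (Bu + B))) (C₂ := ENNReal.ofReal (κ * (Bu + 3 * B)))
    (Q := (∫⁻ x, ‖curl V x‖ₑ ^ 2) ^ (1 / 2 : ℝ)) ENNReal.ofReal_ne_top ENNReal.ofReal_ne_top
    (ENNReal.rpow_ne_top_of_nonneg (by norm_num) hZV.ne)
  have hεpos : (0 : ℝ≥0∞) < ENNReal.ofReal ε := ENNReal.ofReal_pos.2 hε
  have evZ := ENNReal.tendsto_nhds_zero.1 hΓZ _ hεpos
  have evP := ENNReal.tendsto_nhds_zero.1 hΓP _ hεpos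
  have evS := ENNReal.tendsto_nhds_zero.1 hΓS _ hεpos
  -- Step 4: the sup bound far out
  obtain ⟨R₀, hR₀, hfar⟩ := exists_forall_norm_poincareField_le hVA hdec (δ := ε / (K + 1)) (by positivity)
  -- Step 5: choose `R`
  obtain ⟨R, hR1, hRR₀, hZ, hP, hS⟩ := ((eventually_ge_atTop (1 : ℝ)).and ((eventually_ge_atTop R₀).and
    (evZ.and (evP.and evS)))).exists
  have hR0 : 0 < R := one_pos.trans_le hR1
  set u := solenoidalTruncation V R with hudef
  have hu : ContDiff ℝ (⊤ : ℕ∞) u := contDiff_solenoidalTruncation hV R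
  have huc : HasCompactSupport u := hasCompactSupport_solenoidalTruncation hR0
  have hudiv : VectorCalculus.IsDivFree u := isDivFree_solenoidalTruncation finrank_euclideanSpace_fin hV1 hVdiv R
  refine ⟨u, c, hu, huc, hudiv, fun x => ?_, ?_, ?_, ?_⟩
  · -- sup bound
    have h0 := (hK V hV R hR1 x).1
    have hconv : ‖cutoff R x • V x + c‖ ≤ M := by
      have hχ0 := cutoff_nonneg R x
      have hχ1 := cutoff_le_one R x
      have hrw : cutoff R x • V x + c = cutoff R x • w x + (1 - cutoff R x) • c := by
        simp only [hVdef, smul_sub, sub_smul, one_smul]; abel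
      rw [hrw]
      calc ‖cutoff R x • w x + (1 - cutoff R x) • c‖ ≤ ‖cutoff R x • w x‖ + ‖(1 - cutoff R x) • c‖ := norm_add_le _ _
        _ = cutoff R x * ‖w x‖ + (1 - cutoff R x) * ‖c‖ := by
            rw [norm_smul, norm_smul, Real.norm_of_nonneg hχ0, Real.norm_of_nonneg (by linarith)]
        _ ≤ cutoff R x * M + (1 - cutoff R x) * M :=
            add_le_add (mul_le_mul_of_nonneg_left (hM x) hχ0) (mul_le_mul_of_nonneg_left hcM (by linarith))
        _ = M := by ring
    have herr : ‖u x - cutoff R x • V x‖ ≤ ε := by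
      refine h0.trans ?_
      by_cases hxA : x ∈ {x : EuclideanSpace ℝ (Fin 3) | R ≤ ‖x‖ ∧ ‖x‖ ≤ 2 * R}
      · rw [indicator_of_mem hxA]
        have hFx : ‖poincareField V x‖ ≤ ε / (K + 1) := hfar x (hRR₀.trans hxA.1)
        calc K * ‖poincareField V x‖ ≤ K * (ε / (K + 1)) := by gcongr
          _ ≤ ε := by
              rw [mul_div_assoc']
              rw [div_le_iff₀ (by positivity)]
              nlinarith
      · rw [indicator_of_notMem hxA, mul_zero]; exact hε.le
    calc ‖u x + c‖ = ‖(u x - cutoff R x • V x) + (cutoff R x • V x + c)‖ := by congr 1; abel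
      _ ≤ ‖u x - cutoff R x • V x‖ + ‖cutoff R x • V x + c‖ := norm_add_le _ _
      _ ≤ ε + M := add_le_add herr hconv
      _ = M + ε := add_comm _ _
  · -- stretching
    have h := enorm_integral_stretching_sub_le hu huc hV (hDu R hR1) hBV hZV
    have h' : ‖(∫ x, ⟪curl u x, fderiv ℝ u x (curl u x)⟫) - ∫ x, ⟪curl w x, fderiv ℝ w x (curl w x)⟫‖ₑ ≤
        ENNReal.ofReal ε := by
      have hVw : (∫ x, ⟪curl V x, fderiv ℝ V x (curl V x)⟫) = ∫ x, ⟪curl w x, fderiv ℝ w x (curl w x)⟫ := by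
        simp_rw [hcurlV, hDV]
      rw [← hVw]
      exact h.trans hS
    exact abs_le_of_enorm_le hε.le h'
  · -- enstrophy
    have h := enorm_integral_curl_sq_sub_le hu huc hV hZV
    rw [← hcurlV]
    exact abs_le_of_enorm_le hε.le (h.trans hZ)
  · -- palinstrophy
    have h := enorm_integral_frobenius_sub_le hu huc hV hPV
    rw [← hcurlV]
    exact abs_le_of_enorm_le hε.le (h.trans hP)

end ExtremiserLiouville

end Summit.NavierStokesRegularity.NavierStokesRegularity.Theorems

end
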